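import Summits.CriticalPhenomena.Ising3DConformalLimit.Theorems.MirrorHoelderCompactnessTwoPointDoublingStubLeanScalePropagation
import HarnessLib

/-!
# Box susceptibility bounded by the axis profile (crux stmt-CriticalPhenomena-1981, line folded-current-repulsion)

On `ℤ³` at `β_c`, with `g(k) = ⟨σ₀σ_{k e₀}⟩⁺ = criticalTwoPoint 3 (Pi.single 0 k)` and
`χ_M = Σ_{x ∈ Λ_M} ⟨σ₀σ_x⟩⁺` (`Λ_M = box 3 M`, the sup-norm ball): `χ_M ≤ 1 + Σ_{k=1}^{M} 54 k² g(k)`.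
Proof: sup-norm Messager–Miracle-Solé (`⟨σ₀σ_x⟩ ≤ g(‖x‖_∞)`, `criticalTwoPoint_axis_sandwich`) plus shell
counting (`|∂Λ_{k}| ≤ 6(2k+1)² ≤ 54 k²`, `sum_sphere_le`), by induction on `M` (`sum_box_succ`).
Helper for the √n-doubling partial of item stmt-CriticalPhenomena-6150, line folded-current-repulsion of
crux stmt-CriticalPhenomena-1981. Nothing else is here (the log-convexity lemmas of that line live elsewhere).
-/

noncomputable section

namespace Summit.CriticalPhenomena.Ising3DConformalLimit.Cruxes.ExistsScaleCovariantLimit.FoldedCurrentRepulsion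

open scoped BigOperators
open Finset Literature.Probability.LatticeModels
open Summit.CriticalPhenomena.Ising3DConformalLimit.Cruxes.TwoPointDoubling.Birth

/-- **Box susceptibility vs. axis profile.** For every `M`,
`Σ_{x ∈ Λ_M} ⟨σ₀σ_x⟩⁺_{β_c(3)} ≤ 1 + Σ_{k=1}^{M} 54 k² ⟨σ₀σ_{k e₀}⟩⁺_{β_c(3)}`: the origin contributes `1`,
and on the shell `‖x‖_∞ = k ≥ 1` (at most `6(2k+1)² ≤ 54 k²` sites) the Messager–Miracle-Solé inequality in
the sup norm gives `⟨σ₀σ_x⟩ ≤ ⟨σ₀σ_{k e₀}⟩`.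
[cite: MessagerMiracleSoleJSP1977, main theorem (monotonicity of ⟨σ₀σ_x⟩ under reflections)] -/
theorem box_sum_le_axis_sum : ∀ M : ℕ, ∑ x ∈ Literature.Probability.LatticeModels.box 3 M, Literature.Probability.LatticeModels.criticalTwoPoint 3 x ≤ 1 + ∑ k ∈ Finset.Icc 1 M, 54 * (k : ℝ) ^ 2 * Literature.Probability.LatticeModels.criticalTwoPoint 3 (Pi.single 0 (k : ℤ)) := by
  intro M
  induction M with
  | zero =>
    have h0 : box 3 0 = {0} := by
      ext x
      simp only [mem_box_iff_supNorm_le, Nat.le_zero, Site.supNorm_eq_zero_iff, Finset.mem_singleton]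
    simp [h0, criticalTwoPoint_zero']
  | succ M ih =>
    rw [sum_box_succ, Finset.sum_Icc_succ_top (show 1 ≤ M + 1 by omega)]
    -- on the shell `‖x‖_∞ = M+1`: `⟨σ₀σ_x⟩ ≤ g(M+1) =: B`
    set B : ℝ := criticalTwoPoint 3 (Pi.single 0 ((M + 1 : ℕ) : ℤ))
    have hB0 : 0 ≤ B := criticalTwoPoint_nonneg' _
    have hshell : ∀ x : Site 3, Site.supNorm x = M + 1 → criticalTwoPoint 3 x ≤ B := by
      intro x hx
      have h1 := (criticalTwoPoint_axis_sandwich (y := x) (by omega)).2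
      rw [hx] at h1
      exact h1
    have hS := sum_sphere_le (criticalTwoPoint 3) M hB0 hshell
    -- shell count: `6 (2M+3)² ≤ 54 (M+1)²`
    have hsq : 6 * (2 * M + 3 : ℝ) ^ 2 * B ≤ 54 * ((M + 1 : ℕ) : ℝ) ^ 2 * B := by
      refine mul_le_mul_of_nonneg_right ?_ hB0
      have hM : (0 : ℝ) ≤ M := Nat.cast_nonneg M
      push_cast
      nlinarith [sq_nonneg (M : ℝ), hM]
    linarith [ih, hS, hsq]

end Summit.CriticalPhenomena.Ising3DConformalLimit.Cruxes.ExistsScaleCovariantLimit.FoldedCurrentRepulsion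

end
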